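/-
Copyright (c) 2026 the pub-hodgecm-mathlib formalisation cell (harness21).  Prover seat hodgecm-mathlib-LH4-p01 (g13), 2026-09-03.  Line LH4 (closer row
`stub_N6nsDyadic`, leaf LHD organ (D-RAM) `stub_DyRamCore`): census default «cheapest organ-side brick» — the ONE atom behind the `|2|_w = 1` binder of the
ramified `U(1,1)` edge ∕ vertex frame, re-proved WITHOUT `|2|_w = 1` at every ramified place that carries a SKEW UNIFORMISER (Jacobowitz's «R-P» places,
tame or wild).
-/
import Literature.NumberTheory.Automorphic.UnitaryTwoEdgeStabilizerResidualDichotomyRamified   -- ★ p847088 FILE A (tame twin, `h2w`): `coe_mem_glInt_iff_forall_v_le_one`, `v_det_coe_eq_one_of_mem_placeForm`, `placeForm_antidiagOne`, skew-part currency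
import Literature.NumberTheory.Automorphic.RamifiedPlaceDifferent                               -- ★ p850872: `not_exists_skew_uniformizer_and_skew_unit` (a skew uniformiser and a skew unit never coexist)
import Literature.NumberTheory.Rogawski1990.UnitaryVertexStabilizerCoverCM                       -- ★ `galAdicCompletionMap_involutive` (`σ_w ∘ σ_w = id`)
import HarnessLib

/-!
# The residual dichotomy of the ramified `U(1,1)` edge stabiliser WITHOUT `|2|_w = 1`: places with a skew uniformiser
(Tits 1979 §3.9; Jacobowitz 1962 §§9–11; Serre, *Local Fields* IV §2)

Topic `NumberTheory/Automorphic`; namespace `Literature.NumberTheory.Automorphic.UnitaryGroup`.  THEOREMS ONLY (no definition, no instance, no notation, no named fact,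
no `sorry`); kernel lane `--supports stmt-HodgeConjecture-24833`.  Cell `pub/hodgecm-mathlib`, crux H413, line LH4: leaf `Cruxes/H413/Lines/F0_P3c_DyadicPaydown.lean`
organ (D-RAM) `stub_DyRamCore` (PRINT [LanglandsShelstad1989 Thm. p. 484], XL+ of record) — count-neutral base-layer brick named by the LH4-p01 (g12∕g13) census
«(D-RAM) column vs the ★ wild base layer» (site S2, wall 1).
HONEST LABEL: HC_CM is proved only modulo the 7 printed citations (2 remaining: hLiu418 = stmt-HodgeConjecture-24832, h413 = stmt-HodgeConjecture-24833) until rung 0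
closes; this file asserts nothing printed and discharges nothing by itself; (D-RAM) and the closer row `stub_N6nsDyadic` stay PRINT.

THE MATHEMATICS.  `L` CM, `w ∣ v` NON-SPLIT (`c • w = w`) and RAMIFIED (`e(w|v) ≠ 1`), `σ = σ_w` the local involution, and `ϖ` a SKEW UNIFORMISER of `L_w`
(`|ϖ|_w = exp(−1)`, `σϖ = −ϖ`).  Such a `ϖ` exists iff the different exponent `d(w|v)` is odd (★ `exists_skew_uniformizer_iff`): always at a tame place (`d = 1`),
and at a wild place (`v ∣ 2`) exactly for the `L⁺_v(√π)`-type («R-P») places, `d = 2·ord_v 2 + 1`.  The ★ tame files of the «S3-ram» column derive every residual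
statement about the edge stabiliser `K⁰ = U(σ, antidiag(1,1)) ∩ GL₂(𝒪_w)` from the atom «`σ ≡ id (mod 𝔪_w)` and `|2|_w = 1`, so `σ(a)c + σ(c)a = 0` forces
`|2ac| = |ac| < 1`» (★ FILE A `valued_apply_dichotomy_of_mem_glInt_of_ramified`, ★ `valued_skew_apply_lt_one_of_ramified`).  At a wild place `|2|_w < 1` and that
route is dead, but the CONCLUSION survives verbatim at every R-P place through a different atom:
* §1 «NO SKEW UNIT»: an integral skew element `y` (`σy = −y`, `|y| ≤ 1`) has `|y| < 1` — a skew unit cannot coexist with a skew uniformiser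
  (★ `not_exists_skew_uniformizer_and_skew_unit`: `d` would be both odd and even).  Hence `σ(a)c + σ(c)a = 0` with `a, c ∈ 𝒪_w` gives `|a| < 1 ∨ |c| < 1`
  (`x := σ(a)·c` is skew since `σ² = id`, and `|x| = |a|·|c|`).
* §2 THE RESIDUAL DICHOTOMY for `κ ∈ K⁰`: residually DIAGONAL (`|κ₁₀|, |κ₀₁| < 1`) or residually ANTIDIAGONAL (`|κ₀₀|, |κ₁₁| < 1`) — FILE A's proof with §1 in place of
  `|2| = 1`; and its corollary `|κ₁₀| < 1 ↔ |κ₀₁| < 1` (`|det κ| = 1`).  (Group-theoretically: `det κ = ±β∕σβ` with `β ∈ 𝒪_w^×` by Hilbert 90 and `ϖ∕σϖ = −1`; the sign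
  sorts the two types; `K⁰ ∩ SU(1,1) = diag(1,ϖ)·Iw·diag(1,ϖ)⁻¹` is an Iwahori subgroup of `SL₂(L⁺_v)` at every R-P place, of any residue characteristic.)
* §3 the same atom in the Heisenberg skew-line currency `R⁻ = {y | σy = −y} ≤ L ⊗ L⁺_v` (twin of ★ `valued_skew_apply_lt_one_of_ramified`, binder `h2w` ↦ `hϖ hσϖ`).
NOT claimed: anything at the «R-U» places (`d` even: a skew UNIT exists, `K⁰ ∩ SU(1,1) ≅ SL₂(𝒪_v)` is hyperspecial-like and the dichotomy is FALSE there).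
Consumers (wild R-P twins-to-be, by name): ★ FILE B `UnitaryTwoEdgeStabilizerVertexAverageRamified` (`diagType_union_antidiagType_eq_univ`, `measureReal_diagType_eq_half`),
★ FILE C `UnitaryTwoVertexStabilizerBruhatRamified` :209, ★ FILE D `UnitaryTwoVertexEdgeStabilizerMassRatioRamified` (`v_apply_one_zero_lt_one_iff_of_mem` … the (M2) head
`two_mul_measureReal_vertexCover_one_prod_top_eq`), ★ `Rogawski1990.massRatio_ram`, ★ `UnitaryTwoRamifiedDeepFixedEdgesVertices`, and the six ★ callers of
`valued_skew_apply_lt_one_of_ramified` (`LineStrataMeasureRamified`, `HeisenbergStrataMeasureRamified`, `HeisenbergLevelTwoStrata{,SplitIntegral}Ramified`,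
`TorusDeepOrbitalIntegralStrataRamified`, `DepthZeroTransferHValuesLeviRamifiedModular`).

## References
* [Tits1979] J. Tits, *Reductive groups over local fields*, PSPM 33.1 (1979), §3.9 (ramified quasi-split `U(2)`: the tree of `SL₂`, edge vs vertex stabilisers).
* [Jacobowitz1962] R. Jacobowitz, *Hermitian forms over local fields*, Amer. J. Math. 84 (1962), §§9–11 (ramified dyadic «R-P» ∕ «R-U» places).
* [Serre1979] J.-P. Serre, *Local Fields*, GTM 67 (1979), Ch. IV §2 (the quadratic case: `i_G(σ) = ord(σϖ − ϖ)`).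
* [Serre1980Trees] J.-P. Serre, *Trees* (1980), Ch. II §1.3 (Iwahori = edge stabiliser).
-/

set_option autoImplicit false

noncomputable section

open MeasureTheory Measure Set Filter Topology NumberField IsDedekindDomain Matrix ValuativeRel
open scoped ENNReal NNReal ValuativeRel Matrix MatrixGroups

namespace Literature.NumberTheory.Automorphic.UnitaryGroup

open Literature.NumberTheory.Automorphic Literature.NumberTheory.Automorphic.HermitianLatticeTree
open Literature.NumberTheory.Automorphic.UnitaryGroup.HeisRing
open Literature.NumberTheory.Rogawski1990

/-! ## §1 «No skew unit» at a place with a skew uniformiser -/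

section Place

variable (L : Type) [Field L] [NumberField L] [IsCMField L] {v : HeightOneSpectrum (𝓞 ↥(maximalRealSubfield L))}
  (w : PlacesOver L v) (hw : IsCMField.complexConj L • w.1 = w.1)

include hw in
/-- **AN INTEGRAL SKEW ELEMENT IS NOT A UNIT** at a ramified place with a skew uniformiser `ϖ`: `σ_w y = −y`, `|y|_w ≤ 1 ⇒ |y|_w < 1` (else `y` is a skew unit next to the
skew uniformiser `ϖ`, contradicting ★ `not_exists_skew_uniformizer_and_skew_unit` — `d(w|v)` cannot be both odd and even).  No `|2|_w = 1`.
[cite: Jacobowitz1962, §9] [cite: Serre1979, Ch. IV §2] -/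
theorem valued_lt_one_of_galAdicCompletionMap_eq_neg_of_skewUniformizer (he : v.asIdeal.ramificationIdx' w.1.asIdeal ≠ 1)
    {ϖ : w.1.adicCompletion L} (hϖ : Valued.v ϖ = WithZero.exp (-1 : ℤ)) (hσϖ : galAdicCompletionMap (L := L) (IsCMField.complexConj L) hw ϖ = -ϖ)
    {y : w.1.adicCompletion L} (hy : Valued.v y ≤ 1) (hσy : galAdicCompletionMap (L := L) (IsCMField.complexConj L) hw y = -y) :
    Valued.v y < 1 := by
  refine lt_of_le_of_ne hy fun hy1 => ?_
  exact not_exists_skew_uniformizer_and_skew_unit L v w hw he hϖ ⟨⟨ϖ, hϖ, hσϖ⟩, ⟨y, hy1, hσy⟩⟩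

include hw in
/-- **`σ(a)·c + σ(c)·a = 0` with `a, c ∈ 𝒪_w` forces `|a|_w < 1 ∨ |c|_w < 1`** at a ramified place with a skew uniformiser: `x := σ(a)·c` is skew (`σ² = id`) and integral with
`|x| = |a|·|c|`, so §1 gives `|a|·|c| < 1`.  This is the `|2|`-free replacement of the step «`2ac = −((σa − a)c + (σc − c)a)`, `|2| = 1`» of ★ FILE A.
[cite: Tits1979, §3.9] [cite: Jacobowitz1962, §9] -/
theorem valued_lt_one_or_of_galAdicCompletionMap_mul_add_eq_zero (he : v.asIdeal.ramificationIdx' w.1.asIdeal ≠ 1)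
    {ϖ : w.1.adicCompletion L} (hϖ : Valued.v ϖ = WithZero.exp (-1 : ℤ)) (hσϖ : galAdicCompletionMap (L := L) (IsCMField.complexConj L) hw ϖ = -ϖ)
    {a c : w.1.adicCompletion L} (ha : Valued.v a ≤ 1) (hc : Valued.v c ≤ 1)
    (h : galAdicCompletionMap (L := L) (IsCMField.complexConj L) hw a * c + galAdicCompletionMap (L := L) (IsCMField.complexConj L) hw c * a = 0) :
    Valued.v a < 1 ∨ Valued.v c < 1 := by
  have hσx : galAdicCompletionMap (L := L) (IsCMField.complexConj L) hw (galAdicCompletionMap (L := L) (IsCMField.complexConj L) hw a * c) =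
      -(galAdicCompletionMap (L := L) (IsCMField.complexConj L) hw a * c) := by
    rw [map_mul, galAdicCompletionMap_involutive L v w hw a, mul_comm a]
    linear_combination h
  have hxle : Valued.v (galAdicCompletionMap (L := L) (IsCMField.complexConj L) hw a * c) ≤ 1 := by
    rw [Valuation.map_mul, valued_galAdicCompletionMap]; exact mul_le_one' ha hc
  have hx := valued_lt_one_of_galAdicCompletionMap_eq_neg_of_skewUniformizer L w hw he hϖ hσϖ hxle hσx
  rw [Valuation.map_mul, valued_galAdicCompletionMap] at hx
  rcases lt_or_eq_of_le ha with ha' | ha'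
  · exact Or.inl ha'
  rcases lt_or_eq_of_le hc with hc' | hc'
  · exact Or.inr hc'
  rw [ha', hc', one_mul] at hx
  exact absurd hx (lt_irrefl _)

/-! ## §2 The residual dichotomy in `K⁰ = U ∩ GL₂(𝒪_w)` at a place with a skew uniformiser -/

include hw in
/-- **THE RESIDUAL DICHOTOMY IN `K⁰` WITHOUT `|2|_w = 1`.**  For `κ ∈ U(σ_w, (Φ₂)_w) ∩ GL₂(𝒪_w)` at a ramified place with a skew uniformiser `ϖ`: either `|κ₁₀|_w < 1 ∧ |κ₀₁|_w < 1`
(residually diagonal) or `|κ₀₀|_w < 1 ∧ |κ₁₁|_w < 1` (residually antidiagonal).  Unitarity for `antidiag(1,1)` (★ `mem_unitaryGroupOfForm_antidiagonal_iff_sum'`) reads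
`σ(κ₀₀)κ₁₀ + σ(κ₁₀)κ₀₀ = 0 = σ(κ₀₁)κ₁₁ + σ(κ₁₁)κ₀₁`; §1 gives `|κ₀₀| < 1 ∨ |κ₁₀| < 1` and `|κ₀₁| < 1 ∨ |κ₁₁| < 1`, and `|det κ|_w = 1` excludes the mixed cases —
★ FILE A's proof with the atom swapped (tame twin: ★ `valued_apply_dichotomy_of_mem_glInt_of_ramified`). [cite: Tits1979, §3.9] [cite: Jacobowitz1962, §§9–11] -/
theorem valued_apply_dichotomy_of_mem_glInt_of_skewUniformizer (he : v.asIdeal.ramificationIdx' w.1.asIdeal ≠ 1)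
    {ϖ : w.1.adicCompletion L} (hϖ : Valued.v ϖ = WithZero.exp (-1 : ℤ)) (hσϖ : galAdicCompletionMap (L := L) (IsCMField.complexConj L) hw ϖ = -ϖ)
    (u : ↥(unitaryGroupOfForm (galAdicCompletionMap (L := L) (IsCMField.complexConj L) hw) (placeForm (Matrix.of fun i j : Fin 2 => if i.val + j.val + 1 = 2 then (1 : L) else 0) w.1))) (hu : (u : GL (Fin 2) (w.1.adicCompletion L)) ∈ glInt 2 (w.1.adicCompletion L)) :
    (Valued.v (((u : GL (Fin 2) (w.1.adicCompletion L)) : Matrix (Fin 2) (Fin 2) (w.1.adicCompletion L)) 1 0) < 1 ∧ Valued.v (((u : GL (Fin 2) (w.1.adicCompletion L)) : Matrix (Fin 2) (Fin 2) (w.1.adicCompletion L)) 0 1) < 1) ∨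
      (Valued.v (((u : GL (Fin 2) (w.1.adicCompletion L)) : Matrix (Fin 2) (Fin 2) (w.1.adicCompletion L)) 0 0) < 1 ∧ Valued.v (((u : GL (Fin 2) (w.1.adicCompletion L)) : Matrix (Fin 2) (Fin 2) (w.1.adicCompletion L)) 1 1) < 1) := by
  have hint : ∀ i j, Valued.v (((u : GL (Fin 2) (w.1.adicCompletion L)) : Matrix (Fin 2) (Fin 2) (w.1.adicCompletion L)) i j) ≤ 1 := (coe_mem_glInt_iff_forall_v_le_one L w hw u).1 hu
  have hdet : Valued.v (((u : GL (Fin 2) (w.1.adicCompletion L)) : Matrix (Fin 2) (Fin 2) (w.1.adicCompletion L))).det = 1 := v_det_coe_eq_one_of_mem_placeForm L w hw u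
  -- unitarity relations for the antidiagonal form
  have hU : (u : GL (Fin 2) (w.1.adicCompletion L)) ∈ unitaryGroupOfForm (galAdicCompletionMap (L := L) (IsCMField.complexConj L) hw) ((StdForm.antidiagonal 2).over (w.1.adicCompletion L)) := by
    rw [← placeForm_antidiagOne]; exact u.2
  have hrel := (mem_unitaryGroupOfForm_antidiagonal_iff_sum' (galAdicCompletionMap (L := L) (IsCMField.complexConj L) hw) 2 (u : GL (Fin 2) (w.1.adicCompletion L))).1 hU
  have r0 : Fin.rev (0 : Fin 2) = 1 := by decide
  have r1 : Fin.rev (1 : Fin 2) = 0 := by decide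
  have h00 : (galAdicCompletionMap (L := L) (IsCMField.complexConj L) hw) (((u : GL (Fin 2) (w.1.adicCompletion L)) : Matrix (Fin 2) (Fin 2) (w.1.adicCompletion L)) 0 0) * ((u : GL (Fin 2) (w.1.adicCompletion L)) : Matrix (Fin 2) (Fin 2) (w.1.adicCompletion L)) 1 0 + (galAdicCompletionMap (L := L) (IsCMField.complexConj L) hw) (((u : GL (Fin 2) (w.1.adicCompletion L)) : Matrix (Fin 2) (Fin 2) (w.1.adicCompletion L)) 1 0) * ((u : GL (Fin 2) (w.1.adicCompletion L)) : Matrix (Fin 2) (Fin 2) (w.1.adicCompletion L)) 0 0 = 0 := by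
    have h := hrel 0 0
    rw [Fin.sum_univ_two, r0, r1, if_neg (by decide)] at h
    exact h
  have h11 : (galAdicCompletionMap (L := L) (IsCMField.complexConj L) hw) (((u : GL (Fin 2) (w.1.adicCompletion L)) : Matrix (Fin 2) (Fin 2) (w.1.adicCompletion L)) 0 1) * ((u : GL (Fin 2) (w.1.adicCompletion L)) : Matrix (Fin 2) (Fin 2) (w.1.adicCompletion L)) 1 1 + (galAdicCompletionMap (L := L) (IsCMField.complexConj L) hw) (((u : GL (Fin 2) (w.1.adicCompletion L)) : Matrix (Fin 2) (Fin 2) (w.1.adicCompletion L)) 1 1) * ((u : GL (Fin 2) (w.1.adicCompletion L)) : Matrix (Fin 2) (Fin 2) (w.1.adicCompletion L)) 0 1 = 0 := by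
    have h := hrel 1 1
    rw [Fin.sum_univ_two, r0, r1, if_neg (by decide)] at h
    exact h
  -- the atom «no skew unit» in place of `|2| = 1`
  have hA := valued_lt_one_or_of_galAdicCompletionMap_mul_add_eq_zero L w hw he hϖ hσϖ (hint 0 0) (hint 1 0) h00
  have hB := valued_lt_one_or_of_galAdicCompletionMap_mul_add_eq_zero L w hw he hϖ hσϖ (hint 0 1) (hint 1 1) h11
  -- `|det κ| = 1` forbids both products being small
  have hsmall : ¬ (Valued.v (((u : GL (Fin 2) (w.1.adicCompletion L)) : Matrix (Fin 2) (Fin 2) (w.1.adicCompletion L)) 0 0 * ((u : GL (Fin 2) (w.1.adicCompletion L)) : Matrix (Fin 2) (Fin 2) (w.1.adicCompletion L)) 1 1) < 1 ∧ Valued.v (((u : GL (Fin 2) (w.1.adicCompletion L)) : Matrix (Fin 2) (Fin 2) (w.1.adicCompletion L)) 0 1 * ((u : GL (Fin 2) (w.1.adicCompletion L)) : Matrix (Fin 2) (Fin 2) (w.1.adicCompletion L)) 1 0) < 1) := by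
    rintro ⟨h1, h2⟩
    have h : Valued.v (((u : GL (Fin 2) (w.1.adicCompletion L)) : Matrix (Fin 2) (Fin 2) (w.1.adicCompletion L))).det < 1 := by
      rw [Matrix.det_fin_two]; exact Valuation.map_sub_lt _ h1 h2
    rw [hdet] at h; exact lt_irrefl _ h
  rcases hA with h0 | h10
  · right
    refine ⟨h0, ?_⟩
    rcases hB with h01 | h1
    · exact absurd ⟨by rw [Valuation.map_mul]; exact mul_lt_one_of_lt_of_le h0 (hint 1 1),
        by rw [Valuation.map_mul]; exact mul_lt_one_of_lt_of_le h01 (hint 1 0)⟩ hsmall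
    · exact h1
  · left
    refine ⟨h10, ?_⟩
    rcases hB with h01 | h1
    · exact h01
    · exact absurd ⟨by rw [Valuation.map_mul, mul_comm]; exact mul_lt_one_of_lt_of_le h1 (hint 0 0),
        by rw [Valuation.map_mul, mul_comm]; exact mul_lt_one_of_lt_of_le h10 (hint 0 1)⟩ hsmall

include hw in
/-- **On `K⁰`, `|κ₁₀|_w < 1 ↔ |κ₀₁|_w < 1`** at a ramified place with a skew uniformiser: by §2 `κ` is residually diagonal (both hold) or residually antidiagonal, and in the
latter case neither holds (`|κ₀₀κ₁₁ − κ₀₁κ₁₀| = |det κ| = 1` with `|κ₀₀κ₁₁| < 1` forces `|κ₀₁κ₁₀| = 1`).  Place-level content of ★ FILE D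
`v_apply_one_zero_lt_one_iff_of_mem` without `|2|_w = 1`. [cite: Tits1979, §3.9] [cite: Serre1980Trees, Ch. II §1.3] -/
theorem valued_apply_one_zero_lt_one_iff_of_mem_glInt_of_skewUniformizer (he : v.asIdeal.ramificationIdx' w.1.asIdeal ≠ 1)
    {ϖ : w.1.adicCompletion L} (hϖ : Valued.v ϖ = WithZero.exp (-1 : ℤ)) (hσϖ : galAdicCompletionMap (L := L) (IsCMField.complexConj L) hw ϖ = -ϖ)
    (u : ↥(unitaryGroupOfForm (galAdicCompletionMap (L := L) (IsCMField.complexConj L) hw) (placeForm (Matrix.of fun i j : Fin 2 => if i.val + j.val + 1 = 2 then (1 : L) else 0) w.1))) (hu : (u : GL (Fin 2) (w.1.adicCompletion L)) ∈ glInt 2 (w.1.adicCompletion L)) :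
    Valued.v (((u : GL (Fin 2) (w.1.adicCompletion L)) : Matrix (Fin 2) (Fin 2) (w.1.adicCompletion L)) 1 0) < 1 ↔
      Valued.v (((u : GL (Fin 2) (w.1.adicCompletion L)) : Matrix (Fin 2) (Fin 2) (w.1.adicCompletion L)) 0 1) < 1 := by
  have hint : ∀ i j, Valued.v (((u : GL (Fin 2) (w.1.adicCompletion L)) : Matrix (Fin 2) (Fin 2) (w.1.adicCompletion L)) i j) ≤ 1 := (coe_mem_glInt_iff_forall_v_le_one L w hw u).1 hu
  have hdet : Valued.v (((u : GL (Fin 2) (w.1.adicCompletion L)) : Matrix (Fin 2) (Fin 2) (w.1.adicCompletion L))).det = 1 := v_det_coe_eq_one_of_mem_placeForm L w hw u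
  rw [Matrix.det_fin_two] at hdet
  rcases valued_apply_dichotomy_of_mem_glInt_of_skewUniformizer L w hw he hϖ hσϖ u hu with hd | ha
  · exact ⟨fun _ => hd.2, fun _ => hd.1⟩
  · have hdiag : Valued.v (((u : GL (Fin 2) (w.1.adicCompletion L)) : Matrix (Fin 2) (Fin 2) (w.1.adicCompletion L)) 0 0 * ((u : GL (Fin 2) (w.1.adicCompletion L)) : Matrix (Fin 2) (Fin 2) (w.1.adicCompletion L)) 1 1) < 1 := by
      rw [Valuation.map_mul]; exact mul_lt_one_of_lt_of_le ha.1 (hint 1 1)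
    constructor
    · intro h10
      have hoff : Valued.v (((u : GL (Fin 2) (w.1.adicCompletion L)) : Matrix (Fin 2) (Fin 2) (w.1.adicCompletion L)) 0 1 * ((u : GL (Fin 2) (w.1.adicCompletion L)) : Matrix (Fin 2) (Fin 2) (w.1.adicCompletion L)) 1 0) < 1 := by
        rw [Valuation.map_mul, mul_comm]; exact mul_lt_one_of_lt_of_le h10 (hint 0 1)
      exact absurd hdet (ne_of_lt (Valuation.map_sub_lt _ hdiag hoff))
    · intro h01
      have hoff : Valued.v (((u : GL (Fin 2) (w.1.adicCompletion L)) : Matrix (Fin 2) (Fin 2) (w.1.adicCompletion L)) 0 1 * ((u : GL (Fin 2) (w.1.adicCompletion L)) : Matrix (Fin 2) (Fin 2) (w.1.adicCompletion L)) 1 0) < 1 := by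
        rw [Valuation.map_mul]; exact mul_lt_one_of_lt_of_le h01 (hint 1 0)
      exact absurd hdet (ne_of_lt (Valuation.map_sub_lt _ hdiag hoff))

end Place

/-! ## §3 The same atom in the Heisenberg skew-line currency `R⁻ ≤ L ⊗ L⁺_v` -/

section SkewLine

variable (L : Type) [Field L] [NumberField L] [IsCMField L] (v : HeightOneSpectrum (𝓞 ↥(maximalRealSubfield L)))
  (w : PlacesOver L v) (hw : IsCMField.complexConj L • w.1 = w.1)

include hw in
/-- **THE INTEGRAL SKEW LINE LIES IN `𝔪_w` AT A PLACE WITH A SKEW UNIFORMISER**: for `y ∈ R⁻` (`σy = −y`) with `|y_w| ≤ 1`, `|y_w| < 1` — the `w`-component `y_w` is skew for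
`σ_w` (★ `conjLocal_apply_eq_of_smul_eq`) and §1 applies.  Twin of ★ `valued_skew_apply_lt_one_of_ramified` with the binder `h2w : |2|_w = 1` replaced by the skew
uniformiser `(hϖ, hσϖ)`; same conclusion, valid at the wild «R-P» places too. [cite: Jacobowitz1962, §9] [cite: Rogawski1990, §1.10 p. 9] -/
theorem valued_skew_apply_lt_one_of_skewUniformizer (he : v.asIdeal.ramificationIdx' w.1.asIdeal ≠ 1)
    {ϖ : w.1.adicCompletion L} (hϖ : Valued.v ϖ = WithZero.exp (-1 : ℤ)) (hσϖ : galAdicCompletionMap (L := L) (IsCMField.complexConj L) hw ϖ = -ϖ)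
    (y : ↥(HeisRing.skewPart (conjLocal L (IsCMField.complexConj L) v))) (hy : Valued.v ((y : LocalRing L v) w) ≤ 1) :
    Valued.v ((y : LocalRing L v) w) < 1 := by
  have hσ : galAdicCompletionMap (L := L) (IsCMField.complexConj L) hw ((y : LocalRing L v) w) = -((y : LocalRing L v) w) := by
    rw [← conjLocal_apply_eq_of_smul_eq (IsCMField.complexConj L) (IsCMField.complexConj_ne_one L) v w hw, (mem_skewPart_iff _ _).1 y.2, Pi.neg_apply]
  exact valued_lt_one_of_galAdicCompletionMap_eq_neg_of_skewUniformizer L w hw he hϖ hσϖ hy hσ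

end SkewLine

end Literature.NumberTheory.Automorphic.UnitaryGroup
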